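import Literature.AlgebraicGeometry.Motives.AlgPoints
import Mathlib.AlgebraicGeometry.Morphisms.SchemeTheoreticallyDominant
import Mathlib.AlgebraicGeometry.Morphisms.UniversallyClosed
import Mathlib.AlgebraicGeometry.Geometrically.Integral
import Mathlib.RingTheory.Flat.FaithfullyFlat.Algebra
import HarnessLib

/-!
# Scheme-theoretically dominant surjections of `K`-schemes: descent of geometric integrality,
# base change in `SchemeOver K`

Small complements to Mathlib's `IsSchemeTheoreticallyDominant` (morphisms with trivial kernel
ideal sheaf) for schemes over a field `K` (`Literature.AlgebraicGeometry.Motives.SchemeOver K =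
Over (Spec K)` with its cartesian monoidal structure, Mathlib `CategoryTheory.Over.cartesianMonoidalCategory`),
as needed for the image of a homomorphism of abelian varieties
(`Motives/AbelianVarietyImage`):

* `SchemeOver.geometricallyIntegral_of_isSchemeTheoreticallyDominant` — **geometric integrality descends along
  a quasi-compact scheme-theoretically dominant surjection** `q : X → Z` of `K`-schemes: for a field
  `L ⊇ K`, `X_L → Z_L` is surjective (so `Z_L` is irreducible) and scheme-theoretically dominant
  (flat base change, Mathlib `IsSchemeTheoreticallyDominant.of_isPullback`), so `Z_L` is reduced
  (Görtz–Wedhorn I, Prop. 5.51-type permanence; EGA IV₂ (4.6.1));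
* `SchemeOver.isPullback_map_left` and the theorems `SchemeOver.isSchemeTheoreticallyDominant_whiskerRight_left`,
  `…whiskerLeft_left`, `…tensorHom_left` (all in the `SchemeOver` namespace): `p ×_K R`, `R ×_K p`
  and `p ×_K p` are scheme-theoretically dominant when `p` is (and quasi-compact), everything being
  flat over the field `K`;
* `ker_le_ker_comp` (the kernel of `i` is contained in that of `u ≫ i`); irreducibility of the
  codomain of a continuous surjection is Mathlib's `Function.Surjective.irreducibleSpace`, and
  surjectivity of a universally closed dominant morphism is Mathlib's (low-priority) instance
  `AlgebraicGeometry.Surjective.of_universallyClosed_of_isDominant` (the former local restatement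
  `surjective_of_universallyClosed_of_isDominant` was removed as a duplicate, dedup-00508).

Mathlib searched (pin): `IsSchemeTheoreticallyDominant` with `of_isPullback`, `isReduced`,
`ker_eq_bot`; `Scheme.Hom.ker_comp`, `Scheme.IdealSheafData.map_bot`/`map_mono`;
`Over.whiskerRight_left`, `BraidedCategory.braiding_naturality_right`, `tensorHom_def`;
`GeometricallyIntegral.geometrically_isIntegral`, `geometrically_iff_of_commRing`,
`flat_and_surjective_SpecMap_iff`, `Function.Surjective.irreducibleSpace` (all used),
`Surjective.of_universallyClosed_of_isDominant` (used by `Motives/AbelianVarietyImage`). No such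
descent statement in Mathlib.

## References

* U. Görtz, T. Wedhorn, *Algebraic Geometry I: Schemes*, 2nd ed. (2020), Prop. 5.51 (products
  with geometrically integral schemes) and (9.8) (schematically dominant morphisms). [GortzWedhorn2020]
* A. Grothendieck, J. Dieudonné, EGA IV₂ (1965), (4.6.1) and §11.10 (morphismes schématiquement
  dominants). [folklore]
-/

universe u

open CategoryTheory CategoryTheory.Limits AlgebraicGeometry MonoidalCategory CartesianMonoidalCategory

noncomputable section

namespace Literature.AlgebraicGeometry.Motives

variable {K : Type u} [Field K]

/-- **Geometric integrality descends along a scheme-theoretically dominant surjection.** If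
`q : X → Z` is a quasi-compact, surjective, scheme-theoretically dominant morphism of `K`-schemes and
`X → Spec K` is geometrically integral, then so is `Z → Spec K`: for a field `L ⊇ K`, the base
change `X_L → Z_L` is again surjective (so `Z_L` is irreducible, `X_L` being integral) and
scheme-theoretically dominant (flat base change), so `Z_L` is reduced. [folklore] -/
theorem SchemeOver.geometricallyIntegral_of_isSchemeTheoreticallyDominant {X Z : SchemeOver K} (q : X ⟶ Z)
    [QuasiCompact q.left] [IsSchemeTheoreticallyDominant q.left] [Surjective q.left]
    [GeometricallyIntegral X.hom] : GeometricallyIntegral Z.hom := by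
  rw [GeometricallyIntegral.eq_geometrically]
  refine geometrically_iff_of_commRing.2 fun L _ _ W fst snd h => ?_
  -- `P = X ×_Z W`, a base change of `X → Spec K` along `Spec L → Spec K`
  have hsq : IsPullback (pullback.snd q.left fst) (pullback.fst q.left fst) fst q.left :=
    (IsPullback.of_hasPullback q.left fst).flip
  have hbig : IsPullback (pullback.fst q.left fst) (pullback.snd q.left fst ≫ snd) X.hom
      (Spec.map (CommRingCat.ofHom (algebraMap K L))) := by
    have h2 := hsq.paste_horiz h.flip
    rw [Over.w q] at h2
    exact h2.flip
  haveI : IsIntegral (pullback q.left fst) :=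
    GeometricallyIntegral.geometrically_isIntegral (f := X.hom) _ _ _ hbig
  -- flatness of `W → Z`
  have hff : (CommRingCat.ofHom (algebraMap K L)).hom.FaithfullyFlat := by
    rw [CommRingCat.hom_ofHom, RingHom.faithfullyFlat_algebraMap_iff]
    infer_instance
  obtain ⟨hflat, -⟩ := (flat_and_surjective_SpecMap_iff _).2 hff
  haveI : Flat fst := MorphismProperty.of_isPullback h.flip hflat
  -- `P → W` is scheme-theoretically dominant and surjective
  haveI : IsSchemeTheoreticallyDominant (pullback.snd q.left fst) :=
    IsSchemeTheoreticallyDominant.of_isPullback (IsPullback.of_hasPullback q.left fst)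
  haveI : Surjective (pullback.snd q.left fst) :=
    MorphismProperty.pullback_snd (P := @Surjective) q.left fst inferInstance
  haveI : IsReduced W := IsSchemeTheoreticallyDominant.isReduced (pullback.snd q.left fst)
  haveI : IrreducibleSpace W :=
    (pullback.snd q.left fst).surjective.irreducibleSpace (pullback.snd q.left fst).continuous
  exact isIntegral_of_irreducibleSpace_of_isReduced W

/-- For a closed immersion `ι : Z → Y` (or any morphism) and `u : W → Z`, the kernel of `ι` is
contained in the kernel of `u ≫ ι`. [folklore] -/
theorem ker_le_ker_comp {W Z Y : Scheme.{u}} (u : W ⟶ Z) (i : Z ⟶ Y) : i.ker ≤ (u ≫ i).ker := by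
  rw [Scheme.Hom.ker_comp, ← Scheme.IdealSheafData.map_bot]
  exact Scheme.IdealSheafData.map_mono _ bot_le

/-! ### Base change of scheme-theoretically dominant morphisms in `SchemeOver K` -/

/-- `(p ▷ R)` on underlying schemes, i.e. `p ×_K R`, is a base change of `p`. [folklore] -/
theorem SchemeOver.isPullback_map_left {X' Z' : SchemeOver K} (p : X' ⟶ Z') (R : SchemeOver K) :
    IsPullback (pullback.map X'.hom R.hom Z'.hom R.hom p.left (𝟙 _) (𝟙 _)
        (by rw [Category.comp_id, Over.w p]) (by simp))
      (pullback.fst X'.hom R.hom) (pullback.fst Z'.hom R.hom) p.left := by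
  refine IsPullback.of_right (h₁₂ := pullback.snd Z'.hom R.hom) (v₁₃ := R.hom) (h₂₂ := Z'.hom)
    ?_ (pullback.lift_fst _ _ _) (IsPullback.of_hasPullback Z'.hom R.hom).flip
  rw [pullback.map, pullback.lift_snd, Category.comp_id, Over.w p]
  exact (IsPullback.of_hasPullback X'.hom R.hom).flip

/-- Scheme-theoretic dominance of `p ×_K R` for `p` scheme-theoretically dominant and quasi-compact
(flat base change, Mathlib `IsSchemeTheoreticallyDominant.of_isPullback`). [folklore] -/
theorem SchemeOver.isSchemeTheoreticallyDominant_whiskerRight_left {X' Z' : SchemeOver K} (p : X' ⟶ Z')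
    [QuasiCompact p.left] [IsSchemeTheoreticallyDominant p.left] (R : SchemeOver K) [hR : Flat R.hom] :
    IsSchemeTheoreticallyDominant (p ▷ R).left := by
  have hF : Flat (pullback.fst Z'.hom R.hom) :=
    MorphismProperty.pullback_fst (P := @Flat) Z'.hom R.hom hR
  have H := (SchemeOver.isPullback_map_left p R).flip
  exact @IsSchemeTheoreticallyDominant.of_isPullback _ _ _ _ _ _ _ _ H _ _ hF

/-- Scheme-theoretic dominance of `R ×_K p` (by the symmetry of the product). [folklore] -/
theorem SchemeOver.isSchemeTheoreticallyDominant_whiskerLeft_left {X' Z' : SchemeOver K} (p : X' ⟶ Z')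
    [QuasiCompact p.left] [IsSchemeTheoreticallyDominant p.left] (R : SchemeOver K) [Flat R.hom] :
    IsSchemeTheoreticallyDominant (R ◁ p).left := by
  have h : R ◁ p = (β_ R X').hom ≫ (p ▷ R) ≫ (β_ R Z').inv := by
    rw [← Category.assoc, Iso.eq_comp_inv, BraidedCategory.braiding_naturality_right]
  haveI : IsIso (β_ R X').hom.left := inferInstanceAs (IsIso ((Over.forget _).map (β_ R X').hom))
  haveI : IsIso (β_ R Z').inv.left := inferInstanceAs (IsIso ((Over.forget _).map (β_ R Z').inv))
  haveI := SchemeOver.isSchemeTheoreticallyDominant_whiskerRight_left p R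
  rw [h, Over.comp_left, Over.comp_left]
  infer_instance

/-- `p ×_K p` is scheme-theoretically dominant if `p` is (and quasi-compact). [folklore] -/
theorem SchemeOver.isSchemeTheoreticallyDominant_tensorHom_left {X' Z' : SchemeOver K} (p : X' ⟶ Z')
    [QuasiCompact p.left] [IsSchemeTheoreticallyDominant p.left] [Flat X'.hom] [Flat Z'.hom] :
    IsSchemeTheoreticallyDominant (p ⊗ₘ p).left := by
  haveI := SchemeOver.isSchemeTheoreticallyDominant_whiskerRight_left p X'
  haveI := SchemeOver.isSchemeTheoreticallyDominant_whiskerLeft_left p Z'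
  rw [tensorHom_def, Over.comp_left]
  infer_instance

end Literature.AlgebraicGeometry.Motives
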